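import Summits.NavierStokesRegularity.NavierStokesRegularity.Theses.TautLoopKelvin
import Summits.NavierStokesRegularity.NavierStokesRegularity.Theses.CirculationRelay
import Summits.NavierStokesRegularity.NavierStokesRegularity.Theorems.RungReynoldsOne.Negative.WithoutLerayHopfFalse
import Summits.NavierStokesRegularity.NavierStokesRegularity.Theorems.CirculationFloor.Negative.LoadBearing
import Summits.NavierStokesRegularity.NavierStokesRegularity.Theorems.CirculationFloor.Negative.WithoutClassicalFalse
import Summits.NavierStokesRegularity.NavierStokesRegularity.Theorems.CirculationFloor.Negative.ClayVacuity
import Summits.NavierStokesRegularity.NavierStokesRegularity.Theorems.CirculationFloor.Negative.NormalForm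
import Summits.NavierStokesRegularity.NavierStokesRegularity.Theorems.BlowupAssembly
import Summits.NavierStokesRegularity.NavierStokesRegularity.Theorems.BlowupBlowupClayNonuniquenessRefutation
import Literature.Analysis.FluidPDE.NSQuasipotential
import Literature.Analysis.FluidPDE.LoopCirculation

/-!
# Disproof of `CirculationFloor` — findings (crux stmt-NavierStokesRegularity-1538; routes TautLoopKelvin rank 4, CirculationRelay rank 9)

Seeded by the REFUTER-FIRST crux attack (`refuter-rattack-stmt-NavierStokesRegularity-1538-0`, 2026-08-17,
one cycle; `lean check` rc 0, 0 sorry); EXTENDED by the crux disprover `refuter-cdisprove-stmt-NavierStokesRegularity-1538-0`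
(cycle 1, 2026-08-17: §5 the classical hypothesis is load-bearing, §2 exact Clay vacuity, §6 normal form; rc 0,
0 sorry). Later seats: EXTEND this file,
do not restart it. The load-bearing lemmas are LANDED in the importable Negative lane (both ACCEPTED, imported above):
`Summits/…/Theorems/CirculationFloor/Negative/LoadBearing.lean` (p150054: `circulationFloor_false_without_noExtension`,
`circulationFloor_false_without_LerayHopf`, `not_navierStokesRegularity_of_not_circulationFloor`,
`circle_inner_const_integral_eq_zero`) and `…/Negative/WithoutClassicalFalse.lean` (p158643:
`circulationFloor_false_without_classical`, `isLerayHopfOn_of_sliceNull`, `not_hasSmoothExtensionPast_of_pointSpike`,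
`abs_circleIntegral_le_of_norm_le_one`), namespace `…Theorems.CirculationFloor.Negative`.

LOAD-BEARING TABLE (one line per hypothesis of the crux; details in §3–§5):
* `IsClassicalNSSolutionOn (Ico 0 T) ν 0 u p` — dropped ⇒ FALSE (§5, point spike on the rest state)      [p158643]
* `IsLerayHopfOn T ν 0 (u 0) u`               — dropped ⇒ FALSE (§3, KNSS parasitic drift)                [p150054]
* `HasRapidSpatialDecay (u 0)`                — untestable in Lean (what remains is a genuine blow-up); on paper
                                                 UNNECESSARY for truth (CS is datum-free; the circulation → block
                                                 conversion needs only slice smoothness + `u t ∈ L²`); the lead's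
                                                 line spends it exactly once, in `sliceRegularity` (Tao 2013 bounded
                                                 derivatives of slices), a convenience for classical convolution IBP.
* `¬ HasSmoothExtensionPast ν 0 u T`          — dropped ⇒ FALSE (§3, rest state)                          [p150054]
* `0 < ν`, `0 < T`                            — decoration (§4, `circulationFloor_iff_withoutPositivity`).
* CONCLUSION SHAPE: `∀ ν`, `∀ δ` carry no content — NORMAL FORM (§6, `circulationFloor_iff_unit`, landed as
  `Negative/NormalForm.lean` p159560): the crux ↔ its instance `ν = 1`, `δ = 1` with the SAME `c₀` (viscosity
  normalisation `Γ ↦ Γ/ν` + Leray similarity, `Γ` invariant); `c₀ν` with absolute `c₀` is the only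
  scaling-consistent level; one dimensionless unknown for any counterexample hunt.

THE CRUX (read-back, `TautLoopKelvin.CirculationFloor = CirculationRelay.CirculationFloor` by `rfl`, see
`circulationFloor_shared`): `∃ c₀ > 0` (absolute) `∀ ν, T > 0 ∀ (u, p)`: classical NS on `ℝ³ × [0,T)` →
Leray–Hopf on `[0,T]` from `u 0` → rapidly decaying datum → NO smooth extension past `T` → `∀ δ > 0 ∃ t ∈ [0,T)`
and a planar circle (centre `c`, orthonormal `e₁ e₂`, radius `0 < r ≤ δ`) with
`c₀ ν ≤ |∫₀^{2π} ⟪u t (c + r cos θ e₁ + r sin θ e₂), −r sin θ e₁ + r cos θ e₂⟫ dθ|` — the genuine line integral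
`∮ u(t)·dl` (`= circulation (u t) (circleLoop c r e₁ e₂)`, tree `circulation_circleLoop`). Coercions / junk:
none. Quantifier order as in the informal text. Scaling: `[Γ] = [ν]`; the NS scaling and the viscosity rescaling
`v = αu(x, αt)` (viscosity `αν`, `Γ_v = αΓ_u`) leave `Γ/ν` invariant, so an ABSOLUTE `c₀` is the right shape.

## Verdict of the attack: RESISTS — the crux is TRUE ON PAPER and a THEOREM OF CLAY (A) in tree
* EXACT VACUITY STATUS (cycle 1, `hypotheses_satisfiable_iff_not_navierStokesRegularity`, landed as
  `Negative/ClayVacuity.lean`): the four hypotheses are jointly satisfiable ↔ ¬(A) (`←` by the proved frame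
  stmt-0055). No junk satisfier, no missing satisfier; `CirculationFloor ↔ (¬(A) → CirculationFloor)`.
* `circulationFloor_of_navierStokesRegularity : NavierStokesRegularity → CirculationFloor` (sorry-free, from
  `Literature.NS.blowup_assembly` + the proved uniqueness `X5b` = `BlowupBlowupClayNonuniqueness_refuted`): the
  five hypotheses describe a finite-energy classical blow-up from a rapidly decaying datum (`X5a`), which (A)+X5b
  exclude. So the item can be closed `refuted` ONLY by a negative solution of the Millennium problem
  (`not_navierStokesRegularity_of_not_circulationFloor`); the route's kill criterion "CirculationFloor refuted ⇒
  pivot to another critical-norm floor" can never fire on truth grounds — only PROVABILITY of the intended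
  circulation → Besov conversion (birth stub `stub_dyadicSmall_of_ballFlux`) is at stake.
* No cheaper kill exists: every object satisfying the hypotheses is such a blow-up (weak–strong uniqueness is
  available because `IsLerayHopfOn` carries the energy inequality; `HasSmoothExtensionPast` is the EXTENSION form
  `∃ T' > T ∃ u' p' classical on Ico 0 T' ∧ u' = u on Ico 0 T`, so "junk after `T`" does not satisfy `¬ext`;
  `IsLerayHopfOn T` also pins the slice `u T` = weak-`L²` limit, met by the intended objects).
* Paper check of the intended proof (contrapositive), INCLUDING the planner's worry "sign-oscillating vorticity
  inside the block could leave only a SUM of circulations large": it does not bite. If every circle of radius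
  `≤ δ` has `|Γ| < c₀ν` at all `t < T`, then (slicing) `|∫_{B_ρ(x)} ω·n| ≤ 2ρ c₀ν` for `ρ ≤ δ`; a radial
  non-increasing kernel `k_j = 2^{3j}κ(2^j·)` supported in `B_{2^{-j}}` is a superposition of ball indicators with
  NON-NEGATIVE weights `−k_j′(ρ) dρ`, so `|k_j * (ω·n)(x)| ≤ ∫₀^δ |k_j′(ρ)| 2ρ c₀ν dρ = 2^{2j} (∫₀¹ 2s|κ′|) c₀ν` —
  absolute values are summed against non-negative layer-cake weights, no cancellation is needed; `κ̂ ≥ cos 1 > 0`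
  on `|η| ≤ 1` (`supp κ ⊂ B₁`), so `Δ̇_j ω = m_j(D)(k_{j+1} * ω)` with a `j`-uniform `L¹` multiplier, and
  `Δ̇_j u = 2^{-j}·(bounded multiplier)(Δ̇_j ω)` by `û = iξ × ω̂/|ξ|²` on the annulus; hence
  `sup_{t<T} 2^{-j}‖Δ̇_j u(t)‖_∞ ≤ C_abs c₀ ν` for `2^{-j} ≤ δ`, and Cheskidov–Shvydkoy Lemma 3.2 (in tree, PROVED:
  `cheskidov_shvydkoy_dyadic_holds`) + continuation give the extension. Size L in Lean (LP blocks in `𝓢'`), true.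

## (a) Load-bearing hypotheses — `_false_without_` theorems
* `circulationFloor_false_without_noExtension` : drop `¬ HasSmoothExtensionPast` ⇒ FALSE (rest state `u ≡ 0`).
* `circulationFloor_false_without_LerayHopf` : drop `IsLerayHopfOn` ⇒ FALSE: the KNSS parasitic drift
  `u = g(t)·driftDir`, `p = −g′(t)x₀`, `g = (1−t)^{-1/2} − 1` (tree `RungReynoldsOneNegative.drift (gI 1)`) is
  classical for every `ν`, has datum `0`, no classical extension past `1`, and ZERO circulation on every loop
  (`circle_inner_const_integral_eq_zero`). MORAL for provers: the energy class must be spent (it is what makes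
  `Δ̇_j u = ∇G_j ×̇ ω` legitimate with `L²`-paid tails, and what turns "no extension" into a singularity).
* `circulationFloor_iff_withoutPositivity` : `0 < ν`, `0 < T` are decoration (`ν ≤ 0`: conclusion trivial since
  `c₀ν ≤ 0 ≤ |·|`; `T ≤ 0`: `HasSmoothExtensionPast` automatic, `hasSmoothExtensionPast_of_nonpos`).
* `circulationFloor_false_without_classical` (§5, cycle 1 of the disprover) : drop `IsClassicalNSSolutionOn` ⇒
  FALSE: the POINT SPIKE `u t x = if t = 1/2 ∧ x = 0 then e₀ else 0` (`ν = T = 1`, `δ = c₀/(8π)`) is Leray–Hopf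
  from the Schwartz datum `0` (every Leray–Hopf clause is an integral or an a.e.-in-time statement, blind to one
  slice value: `Negative.isLerayHopfOn_of_sliceNull`), has NO smooth extension past `1` for free (a classical flow
  agreeing with it on `[0,1)` would have the discontinuous slice `u (1/2)`: `Negative.not_hasSmoothExtensionPast_of_pointSpike`),
  and every circle integral of a field bounded by `1` is `≤ 4πr` (`Negative.abs_circleIntegral_le_of_norm_le_one`),
  so `< c₀` at radius `≤ c₀/(8π)`. MORAL for provers: the Leray–Hopf structure and "no extension" do not see
  slice values while the conclusion is a pointwise line integral — the joint smoothness of `IsClassicalNSSolutionOn`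
  is what makes "no extension" a singularity of the FLOW (not of the representative) and what licenses Stokes on
  discs (`stub_ballFlux_of_smallCircles`); it must be spent at the level of slice regularity, not only through the
  momentum equation.
* NOT testable in Lean (no object satisfies the remaining hypotheses without an actual blow-up): dropping
  `HasRapidSpatialDecay (u 0)` — UNNECESSARY on paper (the Cheskidov–Shvydkoy criterion is datum-free; the
  conversion needs slice smoothness and `u t ∈ L²` only; the lead's line uses decay once, in `sliceRegularity`).
  Intermediate weakenings of `IsLerayHopfOn` (finite-energy slices without energy inequality / weak form) or of
  `IsClassicalNSSolutionOn` (smooth slices without the equation) are equally untestable: with datum `0` the energy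
  inequality forces smooth slices to vanish identically (so the flow extends), and with a non-zero datum a witness
  is a genuine Navier–Stokes evolution, of which the tree has no explicit finite-energy instance on `ℝ³`.

## (b) Tightness / (c) strengthenings — remarks only (nothing constructible)
* The level `c₀ν` cannot be replaced by "every `G > 0`": circulation is scale-invariant, so on a Type-I
  (self-similar-rate) blow-up the circulations of circles of radius `~√(ν(T−t))` stay `O(ν)`; the natural
  strengthening "∀ G ∃ small circles with |Γ| ≥ G" is false on Type-I scenarios if any exist (not Lean-testable).
* "Circles at ALL `t` near `T`" (∀ᶠ t) instead of `∃ t`: plausible (the contrapositive argument is slice-wise: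
  smallness on a sequence `t_k ↑ T` does not suffice for CS, which needs `sup_t`), but the crux only claims `∃ t`
  for each `δ`, which is what the routes consume (`closes` uses one circle at one time). No change recommended.

## Probes (Scratch.lean of the seat, all FAIL as they should)
`aesop` / `exact?` / `simp` on the crux; `exact?` for `CirculationFloor → NavierStokesRegularity` and for
`NavierStokesRegularity → CirculationFloor` (the latter is TRUE but needs `blowup_assembly`, below); `aesop` on
the bare conclusion (decoration test 3c). Birth line `Lines/birth.lean` (3 stubs) read: stub 1 (ball flux from
circle circulations, `2ρε`) and stub 3 (CS + continuation) are known mechanisms; stub 2 is the paper argument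
above; the three signatures chain letter-for-letter (`CirculationFloor_of` is by `exact`). No stub attacked here
(no `line` in the payload); none looks false.

## Line `birth` after the lead's reshape (7 stubs, 2026-08-17) — paper check by the disprover, no target attacked
(payload `line` null, `stuck_stubs` empty; recorded for the lead). ALL SEVEN STUBS ARE TRUE ON PAPER:
* `stub_kernelFactorisation`: `𝓕(∂ₖL) = 2πiξₖ φ₀/(4π²|ξ|²)` is smooth with compact support (annulus), `D = 𝓕 1_{B_θ}`
  is real, even, smooth, `Re D ≥ |B_θ| cos(π/4) > 0` on `|ξ| ≤ 4` for `θ = 1/32` (`|2π x·ξ| ≤ π/4`), so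
  `M k := 𝓕⁻¹[𝓕(∂ₖL)/D]` is Schwartz and REAL (Hermitian symbol), and `M k ⋆ 1_{B_θ} = ∂ₖL` pointwise (both
  continuous); `K₀ = −ΔL` since `𝓕K₀ = φ₀`. No hidden normalisation issue (un-normalised indicator absorbed in `M`).
* `stub_convolutionTransfer`: `∂_{t_m}[F(t) g(x−t)] = (∂ₘF)(t) g(x−t) − F(t)(∂ₘg)(x−t)`, total derivative of an
  integrable `C¹` function with integrable derivative integrates to `0`; the stub's sign is the right one.
* `stub_coreUnitScale`: `K₀ ⋆ v = −(ΔL) ⋆ v = −L ⋆ Δv = L ⋆ curl curl v = Σ ε_{ijk} (∂ⱼL) ⋆ (curl v)ₖ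
  = Σ ε_{ijk} M j ⋆ (1_{B_θ} ⋆ (curl v)ₖ)` — three derivative transfers, each legitimate for Schwartz × (bounded `C¹`
  with bounded derivative), which is exactly what "bounded derivatives of all orders" buys; `|1_{B_θ} ⋆ (curl v)ₖ| ≤ 2θε`
  pointwise is the hypothesis; `C = 4θ Σⱼ ‖M j‖₁` absolute. NO decay / energy needed at this stage (v bounded suffices
  for `blockFn 0 v`; constants have `φ₀(0) = 0` block, consistent with zero curl).
* `stub_blockScaling`: `w := v(2^{-j}·)`: `Δ̇₀w = (Δ̇ⱼv)(2^{-j}·)`, `curl w = 2^{-j}(curl v)(2^{-j}·)`,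
  `∫_{B(2^j x, θ)} curl w·eₘ = 2^{2j} ∫_{B(x, θ2^{-j})} curl v·eₘ`, so the hypothesis at radius `θ2^{-j}` with `ε`
  is the unit hypothesis for `w` with `2^j ε` — exact bookkeeping, true.
* `stub_dyadicBridge`: `blockFn j (u t)` converges absolutely for `u t ∈ L²` (`K_j ∈ L²`); the distributional block of
  the `L²` distribution is that continuous function, whose `essSup = sup`; `t ∈ Ioo 0 T ⊂ Ico 0 T`; `j ≥ J` is
  eventually; `limsup ≤ Kε`. True (pure bookkeeping; mind `U T` = distribution of the `L²` slice `u T`, which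
  `IsLerayHopfOn.memLp` provides).
* `stub_ballFlux_of_smallCircles`, `stub_extension_of_dyadicSmall`: unchanged, known mechanisms (see above).
The disprover's `_false_without_` lemmas are honoured by the line: energy spent in stubs B/3, no-extension in the
final contradiction, classical smoothness in `sliceRegularity` + stub 1 (Stokes on discs) — consistent with §5.
-/

noncomputable section

set_option linter.dupNamespace false

namespace Summit.NavierStokesRegularity.NavierStokesRegularity.Cruxes.CirculationFloor.Disproof

open Set Filter Topology MeasureTheory Real
open scoped InnerProductSpace RealInnerProductSpace
open Literature.Analysis.FluidPDE
open Summit.NavierStokesRegularity.NavierStokesRegularity.Theorems.RungReynoldsOneNegative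
open Summit.NavierStokesRegularity.NavierStokesRegularity.Theses

/-! ## §0 The statement: shared verbatim by the two routes -/

/-- The two route copies of the shared item stmt-1538 are the same proposition, definitionally. -/
theorem circulationFloor_shared : TautLoopKelvin.CirculationFloor = CirculationRelay.CirculationFloor := rfl

/-- The conclusion of the crux for a velocity `u`, horizon `T`, level `G` and radius bound `δ`
(a small circle carrying circulation `≥ G` at some `t < T`). -/
def SmallCircleCarries (u : ℝ → EuclideanSpace ℝ (Fin 3) → EuclideanSpace ℝ (Fin 3)) (T G δ : ℝ) : Prop :=
  ∃ t ∈ Set.Ico 0 T, ∃ (c e₁ e₂ : EuclideanSpace ℝ (Fin 3)) (r : ℝ),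
    0 < r ∧ r ≤ δ ∧ ‖e₁‖ = 1 ∧ ‖e₂‖ = 1 ∧ inner ℝ e₁ e₂ = 0 ∧
    G ≤ |∫ θ in (0 : ℝ)..(2 * Real.pi), inner ℝ (u t (c + (r * Real.cos θ) • e₁ + (r * Real.sin θ) • e₂))
      ((-(r * Real.sin θ)) • e₁ + (r * Real.cos θ) • e₂)|

/-- Read-back: the crux is `∃ c₀ > 0, ∀ …, hyps → ∀ δ > 0, SmallCircleCarries u T (c₀ν) δ` (by `rfl`). -/
theorem circulationFloor_iff :
    TautLoopKelvin.CirculationFloor ↔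
      ∃ c₀ : ℝ, 0 < c₀ ∧ ∀ (ν T : ℝ), 0 < ν → 0 < T →
        ∀ (u : ℝ → EuclideanSpace ℝ (Fin 3) → EuclideanSpace ℝ (Fin 3)) (p : ℝ → EuclideanSpace ℝ (Fin 3) → ℝ),
          IsClassicalNSSolutionOn (Set.Ico 0 T) ν 0 u p → IsLerayHopfOn T ν 0 (u 0) u →
          HasRapidSpatialDecay (u 0) → ¬ HasSmoothExtensionPast ν 0 u T →
          ∀ δ : ℝ, 0 < δ → SmallCircleCarries u T (c₀ * ν) δ :=
  Iff.rfl

/-! ## §1 Helper: constant fields have zero circle circulation -/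

/-- **A constant field has zero circulation around every planar circle**, in the route's angle-integral
form (any centre, frame, radius). [folklore] -/
theorem circle_inner_const_integral_eq_zero (a c e₁ e₂ : EuclideanSpace ℝ (Fin 3)) (r : ℝ) :
    ∫ θ in (0 : ℝ)..2 * π, ⟪(fun _ : EuclideanSpace ℝ (Fin 3) => a) (c + (r * cos θ) • e₁ + (r * sin θ) • e₂),
      (-(r * sin θ)) • e₁ + (r * cos θ) • e₂⟫ = 0 := by
  have hloop : circleLoop c r e₁ e₂ 0 = circleLoop c r e₁ e₂ 1 := by
    have h := periodic_circleLoop c r e₁ e₂ 0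
    rw [zero_add] at h
    exact h.symm
  have h1 : circulation (fun _ : EuclideanSpace ℝ (Fin 3) => a) (circleLoop c r e₁ e₂) = 0 :=
    circulation_const_left (contDiff_circleLoop c r e₁ e₂) hloop a
  rwa [circulation_circleLoop] at h1

/-- No small circle of a spatially constant flow carries a positive circulation. -/
theorem not_smallCircleCarries_drift (g : ℝ → ℝ) {T G δ : ℝ} (hG : 0 < G) :
    ¬ SmallCircleCarries (drift g) T G δ := by
  rintro ⟨t, -, c, e₁, e₂, r, -, -, -, -, -, hle⟩
  have h0 : ∫ θ in (0 : ℝ)..(2 * Real.pi),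
      inner ℝ (drift g t (c + (r * Real.cos θ) • e₁ + (r * Real.sin θ) • e₂))
        ((-(r * Real.sin θ)) • e₁ + (r * Real.cos θ) • e₂) = 0 :=
    circle_inner_const_integral_eq_zero (g t • driftDir) c e₁ e₂ r
  rw [h0, abs_zero] at hle
  exact absurd hle (not_le.2 hG)

/-- No small circle of the rest state carries a positive circulation. -/
theorem not_smallCircleCarries_zero {T G δ : ℝ} (hG : 0 < G) :
    ¬ SmallCircleCarries (0 : ℝ → EuclideanSpace ℝ (Fin 3) → EuclideanSpace ℝ (Fin 3)) T G δ := by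
  rintro ⟨t, -, c, e₁, e₂, r, -, -, -, -, -, hle⟩
  have h0 : ∫ θ in (0 : ℝ)..(2 * Real.pi),
      inner ℝ ((0 : ℝ → EuclideanSpace ℝ (Fin 3) → EuclideanSpace ℝ (Fin 3)) t (c + (r * Real.cos θ) • e₁ + (r * Real.sin θ) • e₂))
        ((-(r * Real.sin θ)) • e₁ + (r * Real.cos θ) • e₂) = 0 :=
    circle_inner_const_integral_eq_zero 0 c e₁ e₂ r
  rw [h0, abs_zero] at hle
  exact absurd hle (not_le.2 hG)

/-! ## §2 The crux is a theorem of Clay (A): refuting it = refuting the summit -/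

/-- **Under Clay (A) the five hypotheses of the crux are contradictory**: a classical Leray–Hopf solution
from a rapidly decaying datum without smooth extension past `T` is the conjunct `X5a` of the blow-up
assembly, and `X5b` (uniqueness in class (A)) is proved in tree. [folklore] -/
theorem hyps_false_of_navierStokesRegularity (hA : _root_.NavierStokesRegularity) {ν T : ℝ} (hν : 0 < ν)
    (hT : 0 < T) {u : ℝ → EuclideanSpace ℝ (Fin 3) → EuclideanSpace ℝ (Fin 3)} {p : ℝ → EuclideanSpace ℝ (Fin 3) → ℝ}
    (hcl : IsClassicalNSSolutionOn (Set.Ico 0 T) ν 0 u p) (hLH : IsLerayHopfOn T ν 0 (u 0) u)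
    (hdec : HasRapidSpatialDecay (u 0)) (hext : ¬ HasSmoothExtensionPast ν 0 u T) : False :=
  Literature.NS.blowup_assembly ⟨⟨ν, hν, T, hT, u, p, ⟨hcl, hext⟩, hLH, hdec⟩,
    not_not.1 Summit.NavierStokesRegularity.NavierStokesRegularity.Theorems.BlowupBlowupClayNonuniqueness_refuted⟩ hA

/-- **`NavierStokesRegularity → CirculationFloor`** (with any constant; here `c₀ = 1`): the crux is a
consequence of the summit, hence cannot be refuted without refuting Clay (A). [folklore] -/
theorem circulationFloor_of_navierStokesRegularity (hA : _root_.NavierStokesRegularity) :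
    TautLoopKelvin.CirculationFloor :=
  ⟨1, one_pos, fun _ _ hν hT _ _ hcl hLH hdec hext _ _ =>
    (hyps_false_of_navierStokesRegularity hA hν hT hcl hLH hdec hext).elim⟩

/-- Contrapositive: **a disproof of `CirculationFloor` disproves Clay (A).** -/
theorem not_navierStokesRegularity_of_not_circulationFloor (h : ¬ TautLoopKelvin.CirculationFloor) :
    ¬ _root_.NavierStokesRegularity :=
  fun hA => h (circulationFloor_of_navierStokesRegularity hA)

/-- **Exact vacuity status (cycle 1; landed as `Negative/ClayVacuity.lean`, p158965): the hypothesis class of the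
crux is inhabited iff Clay (A) fails.** `→`: blow-up assembly as above; `←`: the PROVED frame
`typeICertificateLadder_noBlowupToClay_proof` (stmt-0055: "every classical Leray–Hopf solution from a rapidly
decaying datum extends" ⇒ (A)). So there is no junk satisfier and no missing satisfier: under (A) the crux is
vacuously true with every `c₀`; under ¬(A) it is a statement about EVERY Clay counterexample. [folklore] -/
theorem hypotheses_satisfiable_iff_not_navierStokesRegularity :
    (∃ (ν T : ℝ) (u : ℝ → EuclideanSpace ℝ (Fin 3) → EuclideanSpace ℝ (Fin 3))
        (p : ℝ → EuclideanSpace ℝ (Fin 3) → ℝ), 0 < ν ∧ 0 < T ∧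
        IsClassicalNSSolutionOn (Set.Ico 0 T) ν 0 u p ∧ IsLerayHopfOn T ν 0 (u 0) u ∧
        HasRapidSpatialDecay (u 0) ∧ ¬ HasSmoothExtensionPast ν 0 u T) ↔ ¬ _root_.NavierStokesRegularity := by
  constructor
  · rintro ⟨ν, T, u, p, hν, hT, hcl, hLH, hdec, hext⟩ hA
    exact hyps_false_of_navierStokesRegularity hA hν hT hcl hLH hdec hext
  · intro hnA
    by_contra hne
    push Not at hne
    exact hnA (Summit.NavierStokesRegularity.NavierStokesRegularity.Theorems.typeICertificateLadder_noBlowupToClay_proof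
      fun ν T hν hT u p hcl hLH hdec => hne ν T u p hν hT hcl hLH hdec)

/-- **All content of the crux lives on the blow-up branch**: `CirculationFloor ↔ (¬(A) → CirculationFloor)`. [folklore] -/
theorem circulationFloor_iff_of_not_navierStokesRegularity :
    TautLoopKelvin.CirculationFloor ↔ (¬ _root_.NavierStokesRegularity → TautLoopKelvin.CirculationFloor) := by
  refine ⟨fun h _ => h, fun h => ?_⟩
  by_cases hA : _root_.NavierStokesRegularity
  · exact circulationFloor_of_navierStokesRegularity hA
  · exact h hA

/-! ## §3 (a) Load-bearing hypotheses -/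

/-- The crux with `¬ HasSmoothExtensionPast` deleted. -/
def CirculationFloorWithoutNoExtension : Prop :=
  ∃ c₀ : ℝ, 0 < c₀ ∧ ∀ (ν T : ℝ), 0 < ν → 0 < T →
    ∀ (u : ℝ → EuclideanSpace ℝ (Fin 3) → EuclideanSpace ℝ (Fin 3)) (p : ℝ → EuclideanSpace ℝ (Fin 3) → ℝ),
      IsClassicalNSSolutionOn (Set.Ico 0 T) ν 0 u p → IsLerayHopfOn T ν 0 (u 0) u →
      HasRapidSpatialDecay (u 0) →
      ∀ δ : ℝ, 0 < δ → SmallCircleCarries u T (c₀ * ν) δ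

/-- The crux with `IsLerayHopfOn` (finite energy, energy inequality) deleted. -/
def CirculationFloorWithoutLerayHopf : Prop :=
  ∃ c₀ : ℝ, 0 < c₀ ∧ ∀ (ν T : ℝ), 0 < ν → 0 < T →
    ∀ (u : ℝ → EuclideanSpace ℝ (Fin 3) → EuclideanSpace ℝ (Fin 3)) (p : ℝ → EuclideanSpace ℝ (Fin 3) → ℝ),
      IsClassicalNSSolutionOn (Set.Ico 0 T) ν 0 u p →
      HasRapidSpatialDecay (u 0) → ¬ HasSmoothExtensionPast ν 0 u T →
      ∀ δ : ℝ, 0 < δ → SmallCircleCarries u T (c₀ * ν) δ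

/-- **`¬ HasSmoothExtensionPast` is load-bearing**: the rest state `u ≡ 0`, `p ≡ 0` (`ν = T = δ = 1`) is a
classical Leray–Hopf solution from the Schwartz datum `0` with all circulations `0 < c₀`. [folklore] -/
theorem circulationFloor_false_without_noExtension : ¬ CirculationFloorWithoutNoExtension := by
  rintro ⟨c₀, hc₀, h⟩
  have hdec0 : HasRapidSpatialDecay (0 : EuclideanSpace ℝ (Fin 3) → EuclideanSpace ℝ (Fin 3)) := by
    simpa [drift_zero (gI_zero 1)] using drift_rapidDecay (g := gI 1) (gI_zero 1)
  exact not_smallCircleCarries_zero (by simpa using hc₀)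
    (h 1 1 one_pos one_pos 0 0 (isClassicalNSSolutionOn_zero _ _)
      (isLerayHopfOn_zero (E := EuclideanSpace ℝ (Fin 3)) 1 1) hdec0 1 one_pos)

/-- **`IsLerayHopfOn` is load-bearing**: the parasitic drift `drift (gI 1)`, `driftP (gI 1)` (`ν = T = δ = 1`)
is classical from the datum `0`, has no classical extension past `1`, and no circle carries anything. [folklore] -/
theorem circulationFloor_false_without_LerayHopf : ¬ CirculationFloorWithoutLerayHopf := by
  rintro ⟨c₀, hc₀, h⟩
  exact not_smallCircleCarries_drift (gI 1) (by simpa using hc₀)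
    (h 1 1 one_pos one_pos (drift (gI 1)) (driftP (gI 1)) (drift_isClassical (gI_contDiffOn 1) 1)
      (drift_rapidDecay (gI_zero 1)) (drift_not_hasSmoothExtensionPast (tendsto_abs_gI_atTop 1 one_pos) 1) 1 one_pos)

/-! ## §4 Decoration: the positivity hypotheses -/

/-- For `T ≤ 0` every field extends smoothly past `T` (the rest state on `[0, 1)` agrees with it on
`Ico 0 T = ∅`). [folklore] -/
theorem hasSmoothExtensionPast_of_nonpos {ν T : ℝ} (hT : T ≤ 0)
    (u : ℝ → EuclideanSpace ℝ (Fin 3) → EuclideanSpace ℝ (Fin 3)) : HasSmoothExtensionPast ν 0 u T :=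
  ⟨1, by linarith, 0, 0, isClassicalNSSolutionOn_zero _ _, fun t ht => absurd ht.2 (not_lt.2 (hT.trans ht.1))⟩

/-- The crux with the positivity hypotheses `0 < ν`, `0 < T` deleted. -/
def CirculationFloorWithoutPositivity : Prop :=
  ∃ c₀ : ℝ, 0 < c₀ ∧ ∀ (ν T : ℝ)
    (u : ℝ → EuclideanSpace ℝ (Fin 3) → EuclideanSpace ℝ (Fin 3)) (p : ℝ → EuclideanSpace ℝ (Fin 3) → ℝ),
      IsClassicalNSSolutionOn (Set.Ico 0 T) ν 0 u p → IsLerayHopfOn T ν 0 (u 0) u →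
      HasRapidSpatialDecay (u 0) → ¬ HasSmoothExtensionPast ν 0 u T →
      ∀ δ : ℝ, 0 < δ → SmallCircleCarries u T (c₀ * ν) δ

/-- **`0 < ν` and `0 < T` are decoration**: for `ν ≤ 0` the conclusion is trivial (`c₀ν ≤ 0 ≤ |·|`, circle of
radius `δ` at `t = 0` in the frame `e₀, e₁`), for `T ≤ 0` the no-extension hypothesis is unsatisfiable. [folklore] -/
theorem circulationFloor_iff_withoutPositivity :
    TautLoopKelvin.CirculationFloor ↔ CirculationFloorWithoutPositivity := by
  constructor
  · rintro ⟨c₀, hc₀, h⟩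
    refine ⟨c₀, hc₀, fun ν T u p hcl hLH hdec hext δ hδ => ?_⟩
    rcases le_or_gt T 0 with hT | hT
    · exact absurd (hasSmoothExtensionPast_of_nonpos hT u) hext
    rcases le_or_gt ν 0 with hν | hν
    · refine ⟨0, ⟨le_rfl, hT⟩, 0, EuclideanSpace.single 0 1, EuclideanSpace.single 1 1, δ, hδ, le_rfl,
        by simp, by simp, ?_, (mul_nonpos_iff.2 (Or.inl ⟨hc₀.le, hν⟩)).trans (abs_nonneg _)⟩
      rw [EuclideanSpace.inner_single_left]
      simp
    · exact h ν T hν hT u p hcl hLH hdec hext δ hδ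
  · rintro ⟨c₀, hc₀, h⟩
    exact ⟨c₀, hc₀, fun ν T _ _ u p => h ν T u p⟩

/-! ## §5 (a, cycle 1) The classical hypothesis is load-bearing — LANDED as `Negative/WithoutClassicalFalse.lean` -/

/-- The crux with `IsClassicalNSSolutionOn (Ico 0 T) ν 0 u p` deleted (the pressure then no longer occurs). -/
def CirculationFloorWithoutClassical : Prop :=
  ∃ c₀ : ℝ, 0 < c₀ ∧ ∀ (ν T : ℝ), 0 < ν → 0 < T →
    ∀ (u : ℝ → EuclideanSpace ℝ (Fin 3) → EuclideanSpace ℝ (Fin 3)),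
      IsLerayHopfOn T ν 0 (u 0) u → HasRapidSpatialDecay (u 0) → ¬ HasSmoothExtensionPast ν 0 u T →
      ∀ δ : ℝ, 0 < δ → SmallCircleCarries u T (c₀ * ν) δ

/-- **`IsClassicalNSSolutionOn` is load-bearing** (kernel-checked, tree theorem
`Theorems.CirculationFloor.Negative.circulationFloor_false_without_classical`, p158643): the point spike
`u t x = if t = 1/2 ∧ x = 0 then e₀ else 0` on the rest state (`ν = T = 1`, `δ = c₀/(8π)`) is Leray–Hopf from the
Schwartz datum `0`, has no smooth extension past `1` (its slice at `1/2` is discontinuous), and all its circle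
integrals are `≤ 4πr < c₀`. [folklore] -/
theorem circulationFloor_false_without_classical : ¬ CirculationFloorWithoutClassical :=
  Summit.NavierStokesRegularity.NavierStokesRegularity.Theorems.CirculationFloor.Negative.circulationFloor_false_without_classical

/-- The three testable deletions side by side (all FALSE), for the provers' census: every proof of the crux must
use the classical smoothness, the Leray–Hopf energy structure AND the no-extension hypothesis. [folklore] -/
theorem circulationFloor_loadBearing_summary :
    ¬ CirculationFloorWithoutClassical ∧ ¬ CirculationFloorWithoutLerayHopf ∧ ¬ CirculationFloorWithoutNoExtension :=
  ⟨circulationFloor_false_without_classical, circulationFloor_false_without_LerayHopf,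
    circulationFloor_false_without_noExtension⟩

/-! ## §6 (cycle 1) Normal form — LANDED as `Negative/NormalForm.lean` -/

/-- The crux at viscosity `1` and radius bound `1` (all lifespans), constant `c₀`. -/
def CirculationFloorUnit (c₀ : ℝ) : Prop :=
  ∀ T : ℝ, 0 < T →
    ∀ (u : ℝ → EuclideanSpace ℝ (Fin 3) → EuclideanSpace ℝ (Fin 3)) (p : ℝ → EuclideanSpace ℝ (Fin 3) → ℝ),
      IsClassicalNSSolutionOn (Set.Ico 0 T) 1 0 u p → IsLerayHopfOn T 1 0 (u 0) u →
      HasRapidSpatialDecay (u 0) → ¬ HasSmoothExtensionPast 1 0 u T → SmallCircleCarries u T c₀ 1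

/-- **Normal form** (tree theorem `Theorems.CirculationFloor.Negative.circulationFloor_iff_unit`):
`CirculationFloor ↔ ∃ c₀ > 0, CirculationFloorUnit c₀` — WLOG `ν = 1`, `δ = 1`, same constant. The two
scalings used (`v = ν⁻¹u(ν⁻¹·,·)`, `w = δv(δ²·,δ·)`) are symmetries of the hypothesis class
(`IsClassicalNSSolutionOn.viscosityRescale_set` / `.nsRescale_holds`, `IsLerayHopfOn.viscosityRescale` /
`.nsRescale_holds`, decay lemmas, extension carried back by the inverse scaling) and act on the conclusion by
`Γ ↦ Γ/ν` resp. `(centre, radius, Γ) ↦ (δ·centre, δ·radius, Γ)` (`circleIntegral_const_smul`,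
`circleIntegral_nsRescaleData`). [folklore] -/
theorem circulationFloor_iff_unit :
    TautLoopKelvin.CirculationFloor ↔ ∃ c₀ : ℝ, 0 < c₀ ∧ CirculationFloorUnit c₀ :=
  Summit.NavierStokesRegularity.NavierStokesRegularity.Theorems.CirculationFloor.Negative.circulationFloor_iff_unit

end Summit.NavierStokesRegularity.NavierStokesRegularity.Cruxes.CirculationFloor.Disproof

end
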